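/-
Copyright (c) 2026. All rights reserved.
Released under Apache 2.0 license as described in the file LICENSE.
Authors: abc-iut cell, statement-typer seat abc-iut-L4-t3 (wave 1; gen 8), over abc-iut-w6-d025's archimedean `ι^{An⊢⊞}`-data.
-/
import Literature.AnabelianGeometry.AbsoluteAnabelian.LogFrobeniusArchGenuineIotaAnMono
import Literature.AnabelianGeometry.AbsoluteAnabelian.LogFrobeniusIotaAnMonoChains
import HarnessLib

/-!
# [AbsTopIII] Def 5.4 (iii)/(v), Prop 5.8 (vii): the `ι^{An⊢⊞}`-square at the ARCHIMEDEAN carriers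

S. Mochizuki, *Topics in absolute anabelian geometry III*, J. Math. Sci. Univ. Tokyo 22 (2015) 939–1156
[MochizukiAbsTopIII2015]; manuscript pages (`paper:url-5493eb38cbb7`): Def 5.4 (iii) p. 126 (`Γ⃗×_non`: the one commutative
square `𝒪^× → k̄^× → (k̄^×)^pf` / `𝒪^× → k~ → (k̄^×)^pf`), (v) p. 127 (`Γ⃗×_arc`: the single shell-arrow `k~ ↠ k^×` — NO pair of
distinct parallel chains), Prop 5.8 (vii) p. 142 (`ι^{An⊢⊞}_{w,ε}` for the edges of `Γ⃗×_w`).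

WHY (L4-lead m142 «ARC-SQUARES», the archimedean half of this lineage's law `IotaAnMono.SquaresCommute`
(`LogFrobeniusIotaAnMonoChains`), the one hypothesis the extended contact structure `monoContactIota` needs):
* `IotaAnMono.squaresCommute_of_isArc` — at a setting ALL of whose places are archimedean the law holds for ANY `ι^{An⊢⊞}`-data
  (`SquaresCommuteF true _ _ = True`: `Γ⃗×_arc` has no square);
* `TMMono.ιArcTS_squaresCommuteF` — abc-iut-w6-d025's Boolean-generic edge data `ιArcTS b` satisfy the square at BOTH kinds of
  place (at a nonarchimedean place their stand-in data are identities of the container `k~`, so both composites coincide);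
* ★ `archGenuineMonoAn_squaresCommute`, ★ `archGenuineMonoAnChart_squaresCommute` — **the law HOLDS for abc-iut-w6-d025's
  `ι^{An⊢⊞}`-data at the Aut-holomorphic carriers** `archGenuineMonoAn 𝔄` / `archGenuineMonoAnChart 𝔄` (p481390), for EVERY
  signature `isArc` (genuine `gammaArc` at the archimedean places, identity stand-ins elsewhere).
With this, `MonoTelecoreCoherence.cor510MonoTelecorePinnedIota_of` applies at these carriers as soon as a coherence datum
`K` (the arc `η⊢`, abc-iut-w5-d038's lane) with `K.EtaNatural I` is supplied — conjoined BY NAME then; nothing of it is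
claimed here.  MODEL-LEVEL; refereed pre-IUT material; nothing here bears on [IUTchIII] Cor. 3.12; no side taken; typed ≠ proved.
-/

set_option autoImplicit false

universe v u

open CategoryTheory

namespace Literature.AnabelianGeometry.AbsoluteAnabelian

/-- **abc-iut-w6-d025's edge data satisfy the `ι`-square at both kinds of place**: vacuous at an archimedean place; at a
nonarchimedean place all four data are the identity stand-in, so the two composites coincide.
[cite: MochizukiAbsTopIII2015, Def 5.4 (iii) p. 126] -/
theorem TMMono.ιArcTS_squaresCommuteF (b : Bool) :
    LogVertex.SquaresCommuteF b (fun j => TMMono.ψArc.{v} b j.1) (fun ε hε => TMMono.ιArcTS.{v} b ε hε) := by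
  cases b
  · rfl
  · trivial

namespace LogFrobeniusSetting

namespace IotaAnMono

variable {Vmod : Type u} {isArc : Vmod → Bool} {L : LogFrobeniusSetting Vmod isArc}
variable {hψ : ∀ (w : Vmod) (j : {ν : LogVertex (isArc w) // ν.IsCross}),
  L.ψAnMono w j ⋙ L.forgetMono w ⋙ L.toEmono w ≅ L.κAnMono.inverse}

/-- **At an all-archimedean setting the `ι^{An⊢⊞}`-square holds for any data** (`Γ⃗×_arc` is the single shell-arrow: Def 5.4 (v)).
[cite: MochizukiAbsTopIII2015, Def 5.4 (v) p. 127] -/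
theorem squaresCommute_of_isArc (I : L.IotaAnMono hψ) (h : ∀ w : Vmod, isArc w = true) : I.SquaresCommute := by
  intro w
  suffices key : ∀ (b : Bool), b = true → ∀ (F : {ν : LogVertex b // ν.IsCross} → (L.AnMono ⥤ L.NmonoPlus w))
      (ιF : ∀ {μ₁ μ₂ : LogVertex b} (ε : LogEdgeTS b μ₁ μ₂) (hε : ε.InCore), F ⟨μ₁, hε.isCross_src⟩ ⟶ F ⟨μ₂, hε.isCross_tgt⟩),
      LogVertex.SquaresCommuteF b F ιF from
    key (isArc w) (h w) _ _
  rintro _ rfl _ _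
  trivial

end IotaAnMono

variable (𝔄 : AutHolFieldFunctor.{u}) (Vmod : Type (u + 1)) (isArc : Vmod → Bool)

/-- ★ **the `ι^{An⊢⊞}`-square HOLDS for abc-iut-w6-d025's data at `archGenuineMonoAn 𝔄`**, every signature `isArc`.
[cite: MochizukiAbsTopIII2015, Def 5.4 (iii) p. 126] -/
theorem archGenuineMonoAn_squaresCommute : (archGenuineMonoAn_iotaAnMono 𝔄 Vmod isArc).SquaresCommute :=
  fun w => TMMono.ιArcTS_squaresCommuteF (isArc w)

/-- ★ **… and at `archGenuineMonoAnChart 𝔄`** (the setting with the genuine arrow `ℰ• → ℰ⊢`; p481390's instance of record).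
[cite: MochizukiAbsTopIII2015, Def 5.4 (iii) p. 126] -/
theorem archGenuineMonoAnChart_squaresCommute : (archGenuineMonoAnChart_iotaAnMono 𝔄 Vmod isArc).SquaresCommute :=
  fun w => TMMono.ιArcTS_squaresCommuteF (isArc w)

/-- Hence, at these carriers, the chain of `ι^{An⊢⊞}` along any reachability composes transitively (the hypothesis of
`IotaAnMono.chain_trans` / of the extended contact structure `monoContactIota` discharged).
[cite: MochizukiAbsTopIII2015, Cor 5.10 (iv)(c) p. 148] -/
theorem archGenuineMonoAnChart_chain_trans (w : Vmod) {ν₁ ν₂ ν₃ : LogVertex (isArc w)} (h₁₂ : ν₁.Reach ν₂)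
    (h₂₃ : ν₂.Reach ν₃) (h₁₃ : ν₁.Reach ν₃) :
    (archGenuineMonoAnChart_iotaAnMono 𝔄 Vmod isArc).chain w h₁₂ ≫ (archGenuineMonoAnChart_iotaAnMono 𝔄 Vmod isArc).chain w h₂₃ =
      (archGenuineMonoAnChart_iotaAnMono 𝔄 Vmod isArc).chain w h₁₃ :=
  (archGenuineMonoAnChart_iotaAnMono 𝔄 Vmod isArc).chain_trans (archGenuineMonoAnChart_squaresCommute 𝔄 Vmod isArc) w h₁₂ h₂₃ h₁₃

end LogFrobeniusSetting

end Literature.AnabelianGeometry.AbsoluteAnabelian
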